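import Summits.QuantumFields.YangMills.Theorems.AllWindowsColdBoxBoxHighLineFPRepresentationDefs
import Summits.QuantumFields.YangMills.Theorems.AllWindowsColdBoxBoxHighLineSmearedFPExact
import Summits.QuantumFields.YangMills.Theorems.AllWindowsColdBoxBoxHighLineOrbitJacobianClosed
import Summits.QuantumFields.YangMills.Theorems.WeakCouplingRatesBulkDominatesColdBoxWDlrPlumbing
import Literature.MathematicalPhysics.QuantumFieldTheory.LatticeGaugeShenZhuZhuProofs
import Literature.MathematicalPhysics.QuantumLattice.LatticeGaugeDLRGibbsProofs

/-!
# T-S5.5J preliminaries (for `fpRepresentation : FPRepresentation`, file `…FPRepresentation.lean`): the small-plaquette event, cold wall a.s., ratio arithmetic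

The typed task of planner ym-idea-2 g18 (`Cruxes/BoxHighWindowsSU22/TaskS5Step2Rep.lean`; tree copy ✓`…FPRepresentationDefs`), BY NAME:
for a gauge-invariant observable `0 ≤ F ≤ 1` of the cold box,

  `| E_box[F] − E_box[F · h_J · 1_SP] / E_box[h_J · 1_SP] | ≤ 4δ + 4·P_box(¬SP)`

(`h_J = jacWeight β H r`, `SP = SmallPlaquettes H spl`), given (i) a Landau representative with `r₀`-small box links for every cold-wall
small-plaquette configuration and (ii) `|N_J(V)/Z₀ − 1| ≤ δ ≤ 1/2` for every such representative.

Proof (the planner's design note, with NO `ε → 0`): the EXACT smeared FP identity without positivity ✓`FPExact.integral_mul_div_orbitAverage_eq`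
(`∫ G·h/N_h = ∫ G·1_{N_h ≠ 0}`, fcl-p3 ✓p739859) applied to the invariant observables `G = F·1_SP` and `G = 1_SP`; ON `SP ∩ ColdWall` the
normaliser is `N_J(U) = N_J(U^g) ∈ Z₀[1−δ, 1+δ]` by (i)+(ii) and the invariance ✓`FPExact.orbitAverage_gaugeTransformZd_of_isInteriorGauge`, and
the cold wall holds a.s. (DLR properness ✓`isSpecification_ymSpecification_of_t2Space`); hence the two sandwiches
`Z₀(1−δ)·E[F 1_SP] ≤ E[F h_J 1_SP] ≤ Z₀(1+δ)·E[F 1_SP]`, `Z₀(1−δ)·P(SP) ≤ E[h_J 1_SP] ≤ Z₀(1+δ)·P(SP)`, and `E[F] − E[F 1_SP] ∈ [0, P(¬SP)]`;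
the rest is the elementary `ratio_arith` (`≤ 4δ + 2P(¬SP)`).

Also: `smallPlaquettes_gaugeTransformZd` (gauge invariance of `SP`), `measurableSet_smallPlaquettes`, `measurable_spIndicator`, `ae_coldWall`.
Tree + Mathlib; no definitions; standard axioms.  HONEST LABEL: a support brick (STEP 2 §2(c)) of the XL stub S5 (LINE-19 ⟨stmt-QuantumFields-24004⟩
/⟨24335⟩; U5 ⟨24336⟩); S5/U5 and route AllWindowsColdBox (DRAFT) remain OPEN; the Yang–Mills mass gap is NOT proved by this file; no summit is
proved by a line.  Seat ym-line-fcl-p3 g25.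
-/

set_option autoImplicit false

noncomputable section

open MeasureTheory
open Literature.Probability.LatticeModels (Site)
open Literature.MathematicalPhysics.QuantumFieldTheory (isSpecification_ymSpecification_of_t2Space)
open Literature.MathematicalPhysics.QuantumFieldTheory.AxialGauge (boxEdges)
open Literature.MathematicalPhysics.QuantumLattice
open Summit.QuantumFields.YangMills.Theorems.WeakCouplingRates (boxState plaqCostAt measurable_plaqCostAt)

namespace Summit.QuantumFields.YangMills.Theorems.AllWindowsColdBoxBoxHighLine

namespace FPRep

/-! ## §1 The small-plaquette event -/

/-- `SmallPlaquettes` is gauge invariant (plaquette costs are class functions of holonomies). [folklore] -/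
theorem smallPlaquettes_gaugeTransformZd (H : ℕ) (s : ℝ) (g : Site 4 → SU2) (U : LGConfig 4 SU2) :
    SmallPlaquettes H s (gaugeTransformZd g U) ↔ SmallPlaquettes H s U := by
  unfold SmallPlaquettes
  simp only [plaqCostAt, isZdGaugeInvariant_plaquetteObs (fundamentalRep (Fin 2)) _ _ _ g U]

/-- The indicator of `SP` is gauge invariant. [folklore] -/
theorem spIndicator_gaugeTransformZd (H : ℕ) (spl : ℝ) (g : Site 4 → SU2) (U : LGConfig 4 SU2) :
    spIndicator H spl (gaugeTransformZd g U) = spIndicator H spl U := by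
  unfold spIndicator
  rw [show SmallPlaquettes H spl (gaugeTransformZd g U) ↔ SmallPlaquettes H spl U from smallPlaquettes_gaugeTransformZd H spl g U]

/-- The small-plaquette event is measurable (countably many closed conditions). [folklore] -/
theorem measurableSet_smallPlaquettes (H : ℕ) (s : ℝ) : MeasurableSet {U : LGConfig 4 SU2 | SmallPlaquettes H s U} := by
  have hrepr : {U : LGConfig 4 SU2 | SmallPlaquettes H s U} =
      ⋂ x : Site 4, ⋂ i : Fin 4, ⋂ j : Fin 4,
        {U : LGConfig 4 SU2 | (∀ k, -1 ≤ x k ∧ x k ≤ 2 * (H : ℤ)) → i ≠ j →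
          plaqCostAt (G := SU2) (fundamentalRep (Fin 2)) x i j U ≤ s ^ 2} := by
    ext U
    simp only [Set.mem_setOf_eq, Set.mem_iInter, SmallPlaquettes]
    constructor
    · intro h x i j hx hij; exact h x hx i j hij
    · intro h x hx i j hij; exact h x i j hx hij
  rw [hrepr]
  refine MeasurableSet.iInter fun x => MeasurableSet.iInter fun i => MeasurableSet.iInter fun j => ?_
  by_cases hx : ∀ k, -1 ≤ x k ∧ x k ≤ 2 * (H : ℤ)
  · by_cases hij : i ≠ j
    · have : {U : LGConfig 4 SU2 | (∀ k, -1 ≤ x k ∧ x k ≤ 2 * (H : ℤ)) → i ≠ j →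
          plaqCostAt (G := SU2) (fundamentalRep (Fin 2)) x i j U ≤ s ^ 2} =
          {U | plaqCostAt (G := SU2) (fundamentalRep (Fin 2)) x i j U ≤ s ^ 2} := by
        ext U; simp only [Set.mem_setOf_eq]; exact ⟨fun h => h hx hij, fun h _ _ => h⟩
      rw [this]
      exact measurableSet_le (measurable_plaqCostAt x i j) measurable_const
    · have : {U : LGConfig 4 SU2 | (∀ k, -1 ≤ x k ∧ x k ≤ 2 * (H : ℤ)) → i ≠ j →
          plaqCostAt (G := SU2) (fundamentalRep (Fin 2)) x i j U ≤ s ^ 2} = Set.univ := by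
        ext U; simp only [Set.mem_setOf_eq, Set.mem_univ, iff_true]; exact fun _ h => absurd h hij
      rw [this]; exact MeasurableSet.univ
  · have : {U : LGConfig 4 SU2 | (∀ k, -1 ≤ x k ∧ x k ≤ 2 * (H : ℤ)) → i ≠ j →
        plaqCostAt (G := SU2) (fundamentalRep (Fin 2)) x i j U ≤ s ^ 2} = Set.univ := by
      ext U; simp only [Set.mem_setOf_eq, Set.mem_univ, iff_true]; exact fun h => absurd h hx
    rw [this]; exact MeasurableSet.univ

/-- `spIndicator` is the indicator function of the event `SP`. -/
theorem spIndicator_eq_indicator (H : ℕ) (spl : ℝ) :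
    spIndicator H spl = Set.indicator {U : LGConfig 4 SU2 | SmallPlaquettes H spl U} 1 := by
  funext U
  unfold spIndicator
  by_cases h : SmallPlaquettes H spl U
  · rw [if_pos h, Set.indicator_of_mem (by exact h), Pi.one_apply]
  · rw [if_neg h, Set.indicator_of_notMem (by exact h)]

/-- `spIndicator` is measurable. [folklore] -/
theorem measurable_spIndicator (H : ℕ) (spl : ℝ) : Measurable (spIndicator H spl) := by
  rw [spIndicator_eq_indicator]
  exact measurable_one.indicator (measurableSet_smallPlaquettes H spl)

/-- `spIndicator = 1` on `SP`. -/
theorem spIndicator_of_mem {H : ℕ} {spl : ℝ} {U : LGConfig 4 SU2} (h : SmallPlaquettes H spl U) : spIndicator H spl U = 1 := by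
  unfold spIndicator; rw [if_pos h]

/-- `spIndicator = 0` off `SP`. -/
theorem spIndicator_of_not_mem {H : ℕ} {spl : ℝ} {U : LGConfig 4 SU2} (h : ¬ SmallPlaquettes H spl U) :
    spIndicator H spl U = 0 := by
  unfold spIndicator; rw [if_neg h]

/-- `0 ≤ spIndicator ≤ 1`. -/
theorem spIndicator_mem_Icc (H : ℕ) (spl : ℝ) (U : LGConfig 4 SU2) : 0 ≤ spIndicator H spl U ∧ spIndicator H spl U ≤ 1 := by
  unfold spIndicator; split_ifs <;> norm_num

/-! ## §2 The cold-wall box state: probability, cold wall a.s. -/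

/-- The cold-wall box state is a probability measure. [folklore] -/
theorem isProbabilityMeasure_boxState (β : ℝ) (H : ℕ) : IsProbabilityMeasure (boxState (fundamentalRep (Fin 2)) β H) :=
  isProbabilityMeasure_ymSpecification _ (continuous_fundamentalRep (Fin 2)) β _ _

/-- **Cold wall almost surely** (DLR properness of the specification kernel with flat datum). [folklore] -/
theorem ae_coldWall (β : ℝ) (H : ℕ) : ∀ᵐ U ∂(boxState (fundamentalRep (Fin 2)) β H), ColdWall H U := by
  have hγ : Literature.Probability.LatticeModels.IsSpecification (ymSpecification (d := 4) (fundamentalRep (Fin 2)) β) :=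
    isSpecification_ymSpecification_of_t2Space (fundamentalRep (Fin 2)) (continuous_fundamentalRep (Fin 2)) β
  have hprop := hγ.proper (boxEdges 4 (2 * H + 1)) (fun _ => 1)
  show ∀ᵐ U ∂(ymSpecification (fundamentalRep (Fin 2)) β (boxEdges 4 (2 * H + 1)) (fun _ => 1)), ColdWall H U
  filter_upwards [hprop] with U hU
  exact fun e he => hU e he

/-! ## §3 The elementary ratio arithmetic -/

/-- The ratio book-keeping: from `A ≤ a ≤ A + p`, `0 ≤ a ≤ 1`, `0 ≤ A ≤ 1 − p`, and the two sandwiches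
`Z(1−δ)A ≤ B ≤ Z(1+δ)A`, `Z(1−δ)(1−p) ≤ D ≤ Z(1+δ)(1−p)` (`Z > 0`, `0 ≤ δ ≤ 1/2`, `0 ≤ p ≤ 1`):  `|a − B/D| ≤ 4δ + 4p`. [folklore] -/
theorem ratio_arith {a A B D Z δ p : ℝ} (hZ : 0 < Z) (hδ0 : 0 ≤ δ) (hδ : δ ≤ 1 / 2) (hp0 : 0 ≤ p) (hp1 : p ≤ 1)
    (ha0 : 0 ≤ a) (ha1 : a ≤ 1) (hA0 : 0 ≤ A) (hAq : A ≤ 1 - p) (haA : A ≤ a) (haAp : a ≤ A + p)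
    (hB1 : B ≤ Z * (1 + δ) * A) (hB2 : Z * (1 - δ) * A ≤ B)
    (hD1 : D ≤ Z * (1 + δ) * (1 - p)) (hD2 : Z * (1 - δ) * (1 - p) ≤ D) :
    |a - B / D| ≤ 4 * δ + 4 * p := by
  have h1δ : 0 < 1 - δ := by linarith
  have hq0 : 0 ≤ 1 - p := by linarith
  have hD0 : 0 ≤ D := le_trans (by positivity) hD2
  rcases eq_or_lt_of_le hD0 with hD | hD
  · -- `D = 0`: then `1 − p ≤ 0`, i.e. `p = 1`, and `|a| ≤ 1 ≤ 4p`
    rw [← hD, div_zero, sub_zero, abs_of_nonneg ha0]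
    have hle : Z * (1 - δ) * (1 - p) ≤ 0 := by rw [hD]; exact hD2
    have hq : 1 - p ≤ 0 := by
      by_contra hq
      have hq' : 0 < 1 - p := lt_of_not_ge hq
      have : 0 < Z * (1 - δ) * (1 - p) := by positivity
      linarith
    nlinarith
  · -- `D > 0`, hence `1 − p > 0`
    have hq : 0 < 1 - p := by
      by_contra hq'
      have hq'' : 1 - p ≤ 0 := le_of_not_gt hq'
      have : D ≤ 0 := le_trans hD1 (by nlinarith)
      linarith
    rw [abs_le]
    constructor
    · -- `B/D ≤ (1+δ)A/((1−δ)(1−p)) ≤ A + 4δ + 2p ≤ a + 4δ + 2p`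
      have hBD : B / D ≤ (1 + δ) * A / ((1 - δ) * (1 - p)) := by
        rw [div_le_div_iff₀ hD (by positivity)]
        calc B * ((1 - δ) * (1 - p)) ≤ Z * (1 + δ) * A * ((1 - δ) * (1 - p)) := by
              apply mul_le_mul_of_nonneg_right hB1; positivity
          _ = (1 + δ) * A * (Z * (1 - δ) * (1 - p)) := by ring
          _ ≤ (1 + δ) * A * D := by
              apply mul_le_mul_of_nonneg_left hD2; positivity
      -- `(1+δ)A − A(1−δ)(1−p) = A(δ + δ(1−p) + p) ≤ (1−p)(2δ + p) ≤ (4δ + 2p)(1−δ)(1−p)`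
      have hnum : (1 + δ) * A ≤ (A + (4 * δ + 2 * p)) * ((1 - δ) * (1 - p)) := by
        have h2 : A * (δ + δ * (1 - p) + p) ≤ (1 - p) * (2 * δ + p) := by
          calc A * (δ + δ * (1 - p) + p) ≤ (1 - p) * (δ + δ * (1 - p) + p) := by
                apply mul_le_mul_of_nonneg_right hAq; positivity
            _ ≤ (1 - p) * (2 * δ + p) := by
                apply mul_le_mul_of_nonneg_left _ hq0; nlinarith
        have h3 : (1 - p) * (2 * δ + p) ≤ (4 * δ + 2 * p) * ((1 - δ) * (1 - p)) := by
          have : (4 * δ + 2 * p) * ((1 - δ) * (1 - p)) = (1 - p) * ((2 * δ + p) * (2 * (1 - δ))) := by ring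
          rw [this]
          apply mul_le_mul_of_nonneg_left _ hq0
          nlinarith
        nlinarith
      have : (1 + δ) * A / ((1 - δ) * (1 - p)) ≤ A + (4 * δ + 2 * p) := by
        rw [div_le_iff₀ (by positivity)]; exact hnum
      linarith
    · -- `B/D ≥ (1−δ)A/((1+δ)(1−p)) ≥ (1−δ)A/(1+δ) ≥ A − 2δ`, and `a ≤ A + p`
      have hBD : (1 - δ) / (1 + δ) * A ≤ B / D := by
        rw [le_div_iff₀ hD]
        calc (1 - δ) / (1 + δ) * A * D ≤ (1 - δ) / (1 + δ) * A * (Z * (1 + δ) * (1 - p)) := by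
              apply mul_le_mul_of_nonneg_left hD1; positivity
          _ = Z * (1 - δ) * A * (1 - p) := by field_simp
          _ ≤ Z * (1 - δ) * A * 1 := by
              apply mul_le_mul_of_nonneg_left (by linarith); positivity
          _ = Z * (1 - δ) * A := mul_one _
          _ ≤ B := hB2
      have hfrac : A - 2 * δ ≤ (1 - δ) / (1 + δ) * A := by
        rw [div_mul_eq_mul_div, le_div_iff₀ (by linarith)]
        have hA1 : A ≤ 1 := by linarith
        nlinarith
      linarith

end FPRep

end Summit.QuantumFields.YangMills.Theorems.AllWindowsColdBoxBoxHighLine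

end
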